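import Mathlib
import HarnessLib
import Literature.Analysis.FluidPDE.Vorticity
import Literature.Analysis.FluidPDE.SelfSimilar
import Literature.Analysis.FluidPDE.FlatSwirlGauge
import Summits.NavierStokesRegularity.NavierStokesRegularity.Theorems.AxisTwistDoorSignConeDefs

/-!
# AxisTwistDoor · crux `TiltDominationLoc` (stmt-NavierStokesRegularity-26991) · line `signcone` — SIGN-CONE TOOLKIT
# (bookkeeping lemmas for the registered stubs `stub_planarWedgeRigidity` / `stub_rayRigidity`; helper H1 of the LEAD's list)

Elementary facts about the sign cone `SignCone v = {e : ⟪curl v(s) y, e⟫ ≥ 0 ∀ s < 0, ∀ y}` of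
`…Theorems.AxisTwistDoorSignConeDefs` (ns-imp-p1 p648694; line of ns-idea-6 g7):
* §1 it is a CLOSED CONVEX CONE: `zero_mem_signCone`, `add_mem_signCone`, `smul_mem_signCone`, `isClosed_signCone`,
  `convex_signCone`, `signCone_subset_local` (the cone is inside every local cone; saturation is the converse);
* §2 two-sided directions: `inner_curl_eq_zero_of_mem_neg_mem` (`±e ∈ K ⇒ ⟪ω, e⟫ ≡ 0`, the poloidal/planar node) and
  `mem_signCone_of_add_smul_of_nonpos` (normalisation of a second one-signed direction: `e₀ ∈ K`, `αe₀ + h ∈ K`, `α ≤ 0`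
  ⇒ `h ∈ K`);
* §3 covariance: `curl_nsRescale_slice_apply`, `signCone_nsRescale` (parabolic rescaling) and
  `signCone_subset_signCone_comp_sub` (time shifts into the past).

WHAT THIS IS NOT: bookkeeping only; nothing here bears on the stubs, the crux, the leaf or NS regularity (Clay A OPEN).
Seat ns-atd-p1 (LEAD g4).
-/

noncomputable section

set_option linter.dupNamespace false

namespace Summit.NavierStokesRegularity.NavierStokesRegularity.Theorems.AxisTwistDoorSignConeToolkit

open MeasureTheory Set Function Filter Topology Metric
open scoped InnerProductSpace RealInnerProductSpace
open Literature.Analysis Literature.Analysis.FluidPDE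

open Summit.NavierStokesRegularity.NavierStokesRegularity.Theorems.AxisTwistDoorSignConeDefs (SignCone IsSignSaturated)

variable {v : ℝ → EuclideanSpace ℝ (Fin 3) → EuclideanSpace ℝ (Fin 3)}

/-! ### §1 The sign cone is a closed convex cone -/

/-- `0` is (trivially) a one-signed direction. -/
theorem zero_mem_signCone : (0 : EuclideanSpace ℝ (Fin 3)) ∈ SignCone v :=
  fun s _ y => by simp

/-- The sign cone is closed under addition. -/
theorem add_mem_signCone {e e' : EuclideanSpace ℝ (Fin 3)} (he : e ∈ SignCone v) (he' : e' ∈ SignCone v) :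
    e + e' ∈ SignCone v := fun s hs y => by
  rw [inner_add_right]
  exact add_nonneg (he s hs y) (he' s hs y)

/-- The sign cone is closed under non-negative scaling. -/
theorem smul_mem_signCone {e : EuclideanSpace ℝ (Fin 3)} (he : e ∈ SignCone v) {c : ℝ} (hc : 0 ≤ c) :
    c • e ∈ SignCone v := fun s hs y => by
  rw [real_inner_smul_right]
  exact mul_nonneg hc (he s hs y)

/-- The sign cone is closed (an intersection of closed half-spaces). -/
theorem isClosed_signCone : IsClosed (SignCone v) := by
  have : SignCone v = ⋂ (s : ℝ) (_ : s < 0) (y : EuclideanSpace ℝ (Fin 3)),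
      {e : EuclideanSpace ℝ (Fin 3) | 0 ≤ ⟪curl (v s) y, e⟫_ℝ} := by
    ext e
    simp only [SignCone, mem_setOf_eq, mem_iInter]
  rw [this]
  exact isClosed_iInter fun s => isClosed_iInter fun _ => isClosed_iInter fun y =>
    isClosed_le continuous_const (continuous_const.inner continuous_id)

/-- The sign cone is convex. -/
theorem convex_signCone : Convex ℝ (SignCone v) := by
  intro e he e' he' a b ha hb _
  exact add_mem_signCone (smul_mem_signCone he ha) (smul_mem_signCone he' hb)

/-- The sign cone is contained in every local cone; saturation says the converse. -/
theorem signCone_subset_local {e : EuclideanSpace ℝ (Fin 3)} (he : e ∈ SignCone v) {ρ : ℝ} (hρ : 0 < ρ) :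
    ∃ ρ' : ℝ, 0 < ρ' ∧ ∀ s : ℝ, -ρ' ^ 2 < s → s < 0 →
      ∀ y : EuclideanSpace ℝ (Fin 3), ‖y‖ < ρ' → 0 ≤ ⟪curl (v s) y, e⟫_ℝ :=
  ⟨ρ, hρ, fun s _ hs y _ => he s hs y⟩

/-! ### §2 Two-sided directions: `±e ∈ SignCone` means the vorticity is orthogonal to `e` -/

/-- `e` and `−e` both one-signed means the vorticity is everywhere orthogonal to `e` (for `e = e₃`: the profile is
poloidal, the node shared with W4). -/
theorem inner_curl_eq_zero_of_mem_neg_mem {e : EuclideanSpace ℝ (Fin 3)} (he : e ∈ SignCone v)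
    (hne : -e ∈ SignCone v) : ∀ s < 0, ∀ y, ⟪curl (v s) y, e⟫_ℝ = 0 := fun s hs y => by
  have h1 := he s hs y
  have h2 := hne s hs y
  rw [inner_neg_right] at h2
  linarith

/-- Normalisation of a second one-signed direction: if `e₃ ∈ K` and `αe₃ + h ∈ K` with `α ≤ 0`, then `h ∈ K`. -/
theorem mem_signCone_of_add_smul_of_nonpos {e₀ h : EuclideanSpace ℝ (Fin 3)} (he₀ : e₀ ∈ SignCone v) {α : ℝ}
    (hα : α ≤ 0) (hmem : α • e₀ + h ∈ SignCone v) : h ∈ SignCone v := by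
  have : h = (α • e₀ + h) + (-α) • e₀ := by
    rw [neg_smul]; abel
  rw [this]
  exact add_mem_signCone hmem (smul_mem_signCone he₀ (neg_nonneg.2 hα))

/-! ### §3 Covariance: scaling and time shift do not change the sign cone; rotations rotate it -/

/-- Vorticity of a rescaled slice: `curl (nsRescale c v s) y = c² • curl (v (c²s)) (c y)` (no differentiability needed;
`curl_smul_comp_smul`). -/
theorem curl_nsRescale_slice_apply (c : ℝ) (s : ℝ) (y : EuclideanSpace ℝ (Fin 3)) :
    curl (nsRescale c v s) y = (c ^ 2) • curl (v (c ^ 2 * s)) (c • y) := by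
  rw [show nsRescale c v s = fun y => c • v (c ^ 2 * s) (c • y) from rfl, curl_smul_comp_smul, ← pow_two]

/-- Parabolic rescaling `c • v(c²t, c x)`, `c > 0`, leaves the sign cone unchanged (the curl of the rescaled slice is
`c²` times the rescaled curl). -/
theorem signCone_nsRescale {c : ℝ} (hc : 0 < c) : SignCone (nsRescale c v) = SignCone v := by
  have hc2 : 0 < c ^ 2 := pow_pos hc 2
  ext e
  constructor
  · intro he s hs y
    have hs' : s / c ^ 2 < 0 := div_neg_of_neg_of_pos hs hc2
    have key := he (s / c ^ 2) hs' (c⁻¹ • y)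
    rw [curl_nsRescale_slice_apply, show c ^ 2 * (s / c ^ 2) = s by field_simp, smul_smul,
      mul_inv_cancel₀ hc.ne', one_smul, real_inner_smul_left] at key
    exact (mul_nonneg_iff_of_pos_left hc2).1 key
  · intro he s hs y
    rw [curl_nsRescale_slice_apply, real_inner_smul_left]
    exact mul_nonneg hc2.le (he _ (mul_neg_of_pos_of_neg hc2 hs) _)

/-- Time shifts into the past shrink nothing: `SignCone v ⊆ SignCone (t ↦ v (t − δ))` for `δ ≥ 0`. -/
theorem signCone_subset_signCone_comp_sub {δ : ℝ} (hδ : 0 ≤ δ) :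
    SignCone v ⊆ SignCone (fun t => v (t - δ)) := fun e he s hs y =>
  he (s - δ) (by linarith) y

/-! ### §4 Saturation read contrapositively (appended): directions OFF the sign cone of a saturated profile change sign
at every apex scale -/

/-- **Off-cone directions of a SATURATED profile are two-signed at every apex scale.**  If `w` is sign-saturated and
`n ∉ SignCone w`, then in every apex cylinder `Q(ρ) = (−ρ², 0) × B(0, ρ)` there is a point where `⟪curl w(s) y, n⟫ < 0`
(contrapositive of `IsSignSaturated`).  For the research residue `stub_properWedgeRigidity` (sign cone = pointed planar
wedge `K ⊆ span{e₃, e}`): both normals `±(e₃ × e)` lie off `K`, so the out-of-plane vorticity component takes BOTH signs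
in every apex cylinder («the counterexample twists through its own plane at all scales»). -/
theorem exists_inner_curl_neg_of_not_mem_signCone_of_saturated (hsat : IsSignSaturated v)
    {n : EuclideanSpace ℝ (Fin 3)} (hn : n ∉ SignCone v) {ρ : ℝ} (hρ : 0 < ρ) :
    ∃ s : ℝ, -ρ ^ 2 < s ∧ s < 0 ∧ ∃ y : EuclideanSpace ℝ (Fin 3), ‖y‖ < ρ ∧ ⟪curl (v s) y, n⟫_ℝ < 0 := by
  by_contra h
  push Not at h
  exact hn (hsat n ⟨ρ, hρ, fun s hs1 hs2 y hy => h s hs1 hs2 y hy⟩)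

/-- **Both signs**: if neither `n` nor `−n` is in the sign cone of a saturated profile, the component `⟪ω, n⟫` takes a
negative AND a positive value in every apex cylinder. -/
theorem twoSigned_inner_curl_of_saturated (hsat : IsSignSaturated v)
    {n : EuclideanSpace ℝ (Fin 3)} (hn : n ∉ SignCone v) (hn' : -n ∉ SignCone v) {ρ : ℝ} (hρ : 0 < ρ) :
    (∃ s : ℝ, -ρ ^ 2 < s ∧ s < 0 ∧ ∃ y : EuclideanSpace ℝ (Fin 3), ‖y‖ < ρ ∧ ⟪curl (v s) y, n⟫_ℝ < 0) ∧
      (∃ s : ℝ, -ρ ^ 2 < s ∧ s < 0 ∧ ∃ y : EuclideanSpace ℝ (Fin 3), ‖y‖ < ρ ∧ 0 < ⟪curl (v s) y, n⟫_ℝ) := by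
  refine ⟨exists_inner_curl_neg_of_not_mem_signCone_of_saturated hsat hn hρ, ?_⟩
  obtain ⟨s, hs1, hs2, y, hy, hneg⟩ := exists_inner_curl_neg_of_not_mem_signCone_of_saturated hsat hn' hρ
  refine ⟨s, hs1, hs2, y, hy, ?_⟩
  rw [inner_neg_right] at hneg
  linarith

end Summit.NavierStokesRegularity.NavierStokesRegularity.Theorems.AxisTwistDoorSignConeToolkit

end
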